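import Mathlib
import Summits.Ventures.HodgeRepro.Tier4.Line1.RTFSetting
import Summits.Ventures.HodgeRepro.Tier4.Line1.ConvTest
import Summits.Ventures.HodgeRepro.Tier4.Line1.IsotypicIdempotent
import Summits.Ventures.HodgeRepro.Tier4.Line1.IsotypicSchur

/-!
# Tier4/Line1/ConvAssoc — ASSOCIATIVITY of the setting's convolution, and the HECKE ELEMENTS OF TYPE σ: every test
function `f` gives `f ⋆ eσ` with `(f ⋆ eσ) ⋆ eσ = f ⋆ eσ` (module 5 of plan-1's cut (S3σ) S14082; the displayed class
`htst_conv` of p5's `IdempotentData` p689660 is populated by the kernel)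

Blind re-derivation cell `pub-hodge-repro`, Tier 4 (README §9–§10), seat t4-L1-p3 (prover, LINE L1, gen 3).  Target tree
path `lean/Summits/Ventures/HodgeRepro/Tier4/Line1/ConvAssoc.lean`.  Imports t4-L1-p2's `ConvTest` (`conv_isTest`), this
seat's `IsotypicIdempotent` (p690327) and `IsotypicSchur` (p690696: `conv_eσ_eσ`).  0 printed inputs.

CONTENT.  `integrable_prod_conv_conv`: the integrand `(v, u) ↦ f(v) g(v⁻¹ u) h(u⁻¹ x)` is integrable on `μ.prod μ`
(continuous, support in `tsupport f × (tsupport f · tsupport g)`); **`conv_assoc : S.conv (S.conv f g) h = S.conv f (S.conv g h)`**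
for test functions `f g h` (Fubini `integral_integral_swap` + the substitution `u ↦ v u` by the left invariance of `S.μ`
— the twin of p2's composition law `R_R_eq_R_conv`); **`conv_conv_eσ_eσ : S.conv (S.conv f (eσ)) (eσ) = S.conv f (eσ)`**
and `isTest_conv_eσ` — so for every test function `f` the test function `f ⋆ eσ` is a Hecke element of the displayed
class `tst r ⋆ eσ = tst r` of `IdempotentData` (the `(K, σ)`-finite Hecke algebra `C_c(G) ⋆ eσ` exists in the kernel).
NOT claimed: the algebra structure on that class, the convolution law `hact`, (C1), (C2), the instance's corner forms, or
`P_T4`.  Nothing here says anything about the status of the Hodge conjecture for CM abelian varieties, which is NOT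
proved (HC_CM is NOT proved by anyone in this repository).
-/

set_option autoImplicit false

noncomputable section

namespace Summit.Ventures.HodgeRepro.Tier4.Line1

open MeasureTheory Topology Set
open scoped Pointwise

namespace RTF.Setting

variable {G : Type} [Group G] [TopologicalSpace G] [IsTopologicalGroup G] [MeasurableSpace G] [BorelSpace G]
  (S : Setting G)

section Assoc

/-- the integrand of the associativity law is integrable on `μ.prod μ` (continuous with compact support in
`tsupport f × (tsupport f · tsupport g)`). -/
theorem integrable_prod_conv_conv [SecondCountableTopology G] [T2Space G] {f g h : G → ℂ} (hf : IsTest f)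
    (hg : IsTest g) (hh : IsTest h) (x : G) :
    Integrable (Function.uncurry fun (v u : G) => f v * (g (v⁻¹ * u) * h (u⁻¹ * x))) (S.μ.prod S.μ) := by
  haveI := S.haar
  apply Continuous.integrable_of_hasCompactSupport
  · apply Continuous.mul
    · exact hf.cont.comp continuous_fst
    · apply Continuous.mul
      · exact hg.cont.comp (continuous_fst.inv.mul continuous_snd)
      · exact hh.cont.comp (continuous_snd.inv.mul continuous_const)
  · apply HasCompactSupport.intro (hf.compact.prod (hf.compact.mul hg.compact))
    intro p hp
    show f p.1 * (g (p.1⁻¹ * p.2) * h (p.2⁻¹ * x)) = 0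
    by_cases h1 : p.1 ∈ tsupport f
    · have h2 : p.1⁻¹ * p.2 ∉ tsupport g := by
        intro hm
        apply hp
        refine ⟨h1, ?_⟩
        have : p.2 = p.1 * (p.1⁻¹ * p.2) := by group
        rw [this]
        exact Set.mul_mem_mul h1 hm
      rw [image_eq_zero_of_notMem_tsupport h2, zero_mul, mul_zero]
    · rw [image_eq_zero_of_notMem_tsupport h1, zero_mul]

/-- **ASSOCIATIVITY of the convolution** `(f ⋆ g) ⋆ h = f ⋆ (g ⋆ h)` for test functions (Fubini and the substitution
`u ↦ v u` by the left invariance of `S.μ`). -/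
theorem conv_assoc [SecondCountableTopology G] [T2Space G] [MeasurableMul G] [SFinite S.μ] {f g h : G → ℂ}
    (hf : IsTest f) (hg : IsTest g) (hh : IsTest h) :
    S.conv (S.conv f g) h = S.conv f (S.conv g h) := by
  haveI := S.haar
  funext x
  have hint := S.integrable_prod_conv_conv hf hg hh x
  -- the inner `G`-integral for a fixed `v`, after the substitution `u ↦ v u`
  have hinner : ∀ v : G, S.conv g h (v⁻¹ * x) = ∫ u, g (v⁻¹ * u) * h (u⁻¹ * x) ∂S.μ := by
    intro v
    unfold conv
    have hsub := integral_mul_left_eq_self (μ := S.μ) (fun u => g (v⁻¹ * u) * h (u⁻¹ * x)) v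
    rw [← hsub]
    congr 1
    funext u
    simp only [inv_mul_cancel_left, _root_.mul_inv_rev, mul_assoc]
  calc S.conv (S.conv f g) h x
      = ∫ u, (∫ v, f v * g (v⁻¹ * u) ∂S.μ) * h (u⁻¹ * x) ∂S.μ := rfl
    _ = ∫ u, ∫ v, f v * (g (v⁻¹ * u) * h (u⁻¹ * x)) ∂S.μ ∂S.μ := by
        congr 1
        funext u
        rw [← integral_mul_const]
        congr 1
        funext v
        ring
    _ = ∫ v, ∫ u, f v * (g (v⁻¹ * u) * h (u⁻¹ * x)) ∂S.μ ∂S.μ := (integral_integral_swap hint).symm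
    _ = ∫ v, f v * S.conv g h (v⁻¹ * x) ∂S.μ := by
        congr 1
        funext v
        rw [hinner v, integral_const_mul]
    _ = S.conv f (S.conv g h) x := rfl

end Assoc

section HeckeElements

variable (K : Subgroup G) {d : ℕ} (ρ : K →* Matrix (Fin d) (Fin d) ℂ)
  (hKo : IsOpen (K : Set G)) (hKc : IsCompact (K : Set G)) (hρ : Continuous ρ)

include hKo hKc hρ in
/-- `f ⋆ eσ` is a test function for every test function `f`. -/
theorem isTest_conv_eσ [T2Space G] {f : G → ℂ} (hf : IsTest f) : IsTest (S.conv f (eσ S K ρ)) :=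
  (S.conv_isTest hf (isTest_eσ S K ρ hKo hKc hρ)).1

include hKo hKc hρ in
/-- **HECKE ELEMENTS OF TYPE σ**: for every test function `f`, `(f ⋆ eσ) ⋆ eσ = f ⋆ eσ` — the displayed class
`htst_conv` of `IdempotentData` is populated by `C_c(G) ⋆ eσ`. -/
theorem conv_conv_eσ_eσ [SecondCountableTopology G] [T2Space G] [MeasurableMul G] [SFinite S.μ]
    (hirr : IsIrreducibleRep ρ) {f : G → ℂ} (hf : IsTest f) :
    S.conv (S.conv f (eσ S K ρ)) (eσ S K ρ) = S.conv f (eσ S K ρ) := by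
  rw [S.conv_assoc hf (isTest_eσ S K ρ hKo hKc hρ) (isTest_eσ S K ρ hKo hKc hρ),
    conv_eσ_eσ S K ρ hKo hKc hρ hirr]

end HeckeElements

end RTF.Setting

end Summit.Ventures.HodgeRepro.Tier4.Line1
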